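import Summits.Ventures.DiscreteObjects.UnitDistance.KernelRupQuad
import HarnessLib

/-!
# The 3-colouring CNF from adjacency lists in one pass (`KRup.cnfOfAdjLin`) and the one-piece refutation lemma for `checkAllQ`

Framing (verbatim for the cell): lottery ticket; floor = certified bounds/negative ranges.

Cell `pub-namedobj`, target (U), seat udg g18.  `KRup.cnfOfAdj adj n v₀ v₁` (`KernelRupAdjCnf.lean`, udg g14) reads `adj.getD v []`
for every `v < n`: `Θ(n²)` kernel steps, which alone exceeds the kernel memory guard at `n ≈ 2000` (measured by this seat: `n = 973`
passes in 27 s, `n = 2005` fails with 'excessive memory consumption').  `cnfOfAdjLin adj n v₀ v₁` produces the same clauses in the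
same order (when `adj` has `n` rows) by ONE pass over the rows.  ADMISSIBILITY (`cnfOfAdjLin_all_valid_of`): every clause passes the
recogniser `validClause nb n v₀ v₁` of `KernelRupColouring.lean` as soon as listed neighbours are set bits of `nb`; hence
`KRup.all_true_of_valid` and the soundness of the light checker `KRup.checkAllQ` (`KernelRupQuad.lean`) give the one-piece
refutation lemma `not_proper_of_rupQ` (any start key).  No statement about any graph is made here.
-/

namespace Summit.Ventures.DiscreteObjects.UnitDistance.KRup

/-! ## The 3-colouring CNF from adjacency lists in ONE pass -/

/-- Edge clauses of the vertex `v` with neighbour list `l`: listed `w` with `v < w < n`, three colours each. -/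
def edgeClausesRow (n v : ℕ) (l : List ℕ) : List (List ℕ) :=
  (l.filter fun w => v < w && w < n).flatMap fun w =>
    [[negl v 0, negl w 0], [negl v 1, negl w 1], [negl v 2, negl w 2]]

/-- The edge clauses of the rows `k, k + 1, …` of a list of neighbour lists, in one pass. -/
def edgeClausesRows (n : ℕ) : ℕ → List (List ℕ) → List (List ℕ)
  | _, [] => []
  | k, l :: rest => edgeClausesRow n k l ++ edgeClausesRows n (k + 1) rest

/-- THE LINEAR-TIME CNF: vertex clauses, edge clauses row by row, the two symmetry-breaking units — the clause list of
`cnfOfAdj adj n v₀ v₁` when `adj` has exactly `n` rows, produced without indexing into `adj`. -/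
def cnfOfAdjLin (adj : List (List ℕ)) (n v₀ v₁ : ℕ) : List (List ℕ) :=
  ((List.range n).map fun v => [pos v 0, pos v 1, pos v 2]) ++ edgeClausesRows n 0 adj ++ [[pos v₀ 0], [pos v₁ 1]]

/-- Shape of the clauses produced by `edgeClausesRows`. -/
theorem mem_edgeClausesRows {n : ℕ} : ∀ {k : ℕ} {L : List (List ℕ)} {C : List ℕ}, C ∈ edgeClausesRows n k L →
    ∃ i w c, w ∈ L.getD i [] ∧ k + i < w ∧ w < n ∧ c < 3 ∧ C = [negl (k + i) c, negl w c]
  | k, [], C, h => by simp [edgeClausesRows] at h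
  | k, l :: rest, C, h => by
      simp only [edgeClausesRows, List.mem_append] at h
      rcases h with h | h
      · simp only [edgeClausesRow, List.mem_flatMap, List.mem_filter, Bool.and_eq_true, decide_eq_true_eq,
          List.mem_cons, List.not_mem_nil, or_false] at h
        obtain ⟨w, ⟨hw, hkw, hwn⟩, hC⟩ := h
        rcases hC with rfl | rfl | rfl
        · exact ⟨0, w, 0, by simpa using hw, by simpa using hkw, hwn, by omega, by simp⟩
        · exact ⟨0, w, 1, by simpa using hw, by simpa using hkw, hwn, by omega, by simp⟩
        · exact ⟨0, w, 2, by simpa using hw, by simpa using hkw, hwn, by omega, by simp⟩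
      · obtain ⟨i, w, c, hw, hkw, hwn, hc, rfl⟩ := mem_edgeClausesRows h
        exact ⟨i + 1, w, c, by simpa using hw, by omega, hwn, hc, by rw [show k + (i + 1) = k + 1 + i by omega]⟩

/-- ADMISSIBILITY: if every listed neighbour `w ∈ adj[v]` is a set bit of `nb v`, every clause of `cnfOfAdjLin adj n v₀ v₁`
passes the recogniser `validClause nb n v₀ v₁`. -/
theorem cnfOfAdjLin_all_valid_of {nb : ℕ → ℕ} {adj : List (List ℕ)}
    (h : ∀ v w, w ∈ adj.getD v [] → Nat.testBit (nb v) w = true) (n v₀ v₁ : ℕ) :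
    (cnfOfAdjLin adj n v₀ v₁).all (validClause nb n v₀ v₁) = true := by
  rw [List.all_eq_true]
  intro C hC
  simp only [cnfOfAdjLin, List.mem_append, List.mem_map, List.mem_range, List.mem_cons, List.not_mem_nil,
    or_false] at hC
  rcases hC with (⟨v, hv, rfl⟩ | hC) | rfl | rfl
  · exact validClause_vertex nb n v₀ v₁ hv
  · obtain ⟨i, w, c, hw, hiw, hwn, hc, rfl⟩ := mem_edgeClausesRows hC
    rw [Nat.zero_add] at hiw ⊢
    exact validClause_edge nb n v₀ v₁ (by omega) hwn (h i w hw) hc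
  · simp [validClause]
  · simp [validClause]

/-- ADMISSIBILITY for the neighbour words of the lists themselves (`nb v = listBits adj[v]`). -/
theorem cnfOfAdjLin_all_valid (adj : List (List ℕ)) (n v₀ v₁ : ℕ) :
    (cnfOfAdjLin adj n v₀ v₁).all (validClause (fun v => listBits (adj.getD v [])) n v₀ v₁) = true :=
  cnfOfAdjLin_all_valid_of (fun _ _ hw => testBit_listBits_of_mem _ _ hw) n v₀ v₁

/-- ONE-PIECE REFUTATION in the light format: if `F` passes the recogniser and `checkAllQ` on `QStore.ofList d F` (any start
key) derives the empty clause, the graph has no proper 3-colouring with `v₀ ↦ 0`, `v₁ ↦ 1`. -/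
theorem not_proper_of_rupQ {nb : ℕ → ℕ} {n v₀ v₁ : ℕ} {F : List (List ℕ)} (hF : F.all (validClause nb n v₀ v₁) = true)
    {f d i : ℕ} {steps : List (List ℕ × List ℕ)} (hrun : checkAllQ f d (QStore.ofList d F) i steps = true)
    (hnil : [] ∈ steps.map Prod.fst) {col : ℕ → ℕ} (hP : Proper3 nb n col) (h0 : col v₀ = 0) (h1 : col v₁ = 1) :
    False :=
  checkAllQ_refutes (QStore.All.ofList d (all_true_of_valid hP h0 h1 hF)) hrun hnil

end Summit.Ventures.DiscreteObjects.UnitDistance.KRup
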